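/-
Copyright (c) 2026. All rights reserved.
Released under Apache 2.0 license as described in the file LICENSE.
Authors: abc-iut cell, seat abc-iut-w5-d024 (gen 5).
-/
import Mathlib.GroupTheory.SchurZassenhaus
import Mathlib.Topology.Algebra.ClopenNhdofOne
import Mathlib.Topology.Algebra.OpenSubgroup
import Mathlib.CategoryTheory.CofilteredSystem
import Mathlib.CategoryTheory.Filtered.Basic

/-!
# The profinite Schur–Zassenhaus theorem: existence of a closed complement

Let `G` be a profinite group (compact, Hausdorff, totally disconnected topological group) and `P ⊴ G` a
closed normal subgroup such that, in every finite continuous quotient `G ⧸ V` (`V` open normal), the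
image of `P` has order prime to its index — e.g. `P` pro-`p` and `G ⧸ P` pro-`p′`.  Then `P` has a
CLOSED COMPLEMENT: a closed subgroup `C ≤ G` with `C ⊓ P = ⊥` and `P · C = G`
(`exists_closed_isComplement'_of_coprime`).

Proof: at each open normal level `V`, Mathlib's finite Schur–Zassenhaus theorem
(`Subgroup.exists_right_complement'_of_coprime`) provides complements of the image of `P` in `G ⧸ V`;
recorded inside `G` as subgroups `K ⊇ V` whose image is such a complement, they form an inverse system of
nonempty finite sets under `K ↦ K ⊔ V` (the image of a complement under `G ⧸ V′ → G ⧸ V` is again a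
complement, by the coprimality of the orders — `isComplement'_map_of_coprime`), which has a thread
`(K_V)_V` by `nonempty_sections_of_finite_cofiltered_system`; the closed subgroup `C = ⨅_V K_V` meets `P`
trivially (an element of `C ∩ P` dies in every `G ⧸ V`) and `P · C = G` by compactness (for `g ∈ G` the
closed sets `{k ∈ K_V | g k⁻¹ ∈ P}` are nonempty and directed).

This is the existence half of [cite: RibesZalesskii2010, Thm 2.3.15] (profinite Schur–Zassenhaus);
motivation in the abc-iut cell: the splitting of the wild inertia sequence `1 → P_F → Γ_F → Γ_F/P_F → 1`
of a `p`-adic field (GAP row G-L3d2g2-1 / fact F-1977 at `Γ_F`).  Classical, Mathlib-only; no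
definitions (the inverse system is a `let` inside the proof); nothing here concerns [IUTchIII] Cor. 3.12.
-/

open CategoryTheory
open scoped Pointwise

namespace Literature.GroupTheory

open Subgroup

/-! ### Images of complements -/

section Algebra

variable {F₁ F₂ : Type*} [Group F₁] [Group F₂]

/-- **The image of a complement is a complement (coprime case).** Let `f : F₁ → F₂` be a surjective
homomorphism, `N ⊴ F₁` with complement `C`, and suppose `|f(N)|` is prime to `|C|`. Then `f(C)` is a
complement of `f(N)`. (The elementary step behind the compatibility of Schur–Zassenhaus complements in
an inverse system.) [cite: RibesZalesskii2010, Thm 2.3.15] -/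
theorem isComplement'_map_of_coprime (f : F₁ →* F₂) (hf : Function.Surjective f)
    {N C : Subgroup F₁} [N.Normal] (h : IsComplement' N C)
    (hcop : Nat.Coprime (Nat.card (N.map f)) (Nat.card C)) :
    IsComplement' (N.map f) (C.map f) := by
  haveI hNf : (N.map f).Normal := Subgroup.Normal.map inferInstance f hf
  have hsup : N.map f ⊔ C.map f = ⊤ := by
    rw [← Subgroup.map_sup, h.sup_eq_top]
    exact Subgroup.map_top_of_surjective f hf
  have hmul : ((N.map f : Subgroup F₂) : Set F₂) * ((C.map f : Subgroup F₂) : Set F₂) = Set.univ := by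
    rw [← Subgroup.normal_mul, hsup, Subgroup.coe_top]
  exact isComplement'_of_disjoint_and_mul_eq_univ
    (Subgroup.disjoint_of_coprime_natCard (hcop.coprime_dvd_right (C.card_map_dvd f))) hmul

end Algebra

/-! ### The inverse system of complements -/

section Profinite

universe u

variable {G : Type u} [Group G] [TopologicalSpace G] [IsTopologicalGroup G]

omit [IsTopologicalGroup G] in
/-- Order of open normal subgroups vs. order of the underlying subgroups. [folklore] -/
private theorem coe_le_coe {V' V : OpenNormalSubgroup G} (h : V' ≤ V) :
    ((V' : Subgroup G) : Subgroup G) ≤ (V : Subgroup G) := fun _ hx => h hx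

omit [IsTopologicalGroup G] in
/-- A subgroup containing `V` contains the kernel of `G → G ⧸ V`. [folklore] -/
private theorem le_ker_mk' (V : OpenNormalSubgroup G) {K : Subgroup G} (hVK : (V : Subgroup G) ≤ K) :
    (QuotientGroup.mk' (V : Subgroup G)).ker ≤ K := by
  rwa [QuotientGroup.ker_mk']

omit [IsTopologicalGroup G] in
/-- **Compatibility of complements between levels.** If `V′ ≤ V` are open normal subgroups, `K ⊇ V′`
maps to a complement of the image of `P` in `G ⧸ V′`, and the image of `P` in `G ⧸ V′` has order prime to
its index, then `K ⊔ V` maps to a complement of the image of `P` in `G ⧸ V`.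
[cite: RibesZalesskii2010, Thm 2.3.15] -/
theorem isComplement'_map_sup_of_le (P : Subgroup G) [P.Normal] {V' V : OpenNormalSubgroup G}
    (hle : V' ≤ V) {K : Subgroup G}
    (hK : IsComplement' (P.map (QuotientGroup.mk' (V' : Subgroup G)))
      (K.map (QuotientGroup.mk' (V' : Subgroup G))))
    (hcop : Nat.Coprime (Nat.card (P.map (QuotientGroup.mk' (V' : Subgroup G))))
      (P.map (QuotientGroup.mk' (V' : Subgroup G))).index) :
    IsComplement' (P.map (QuotientGroup.mk' (V : Subgroup G)))
      ((K ⊔ (V : Subgroup G)).map (QuotientGroup.mk' (V : Subgroup G))) := by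
  -- the transition map `f : G ⧸ V' → G ⧸ V`
  have hle' : (V' : Subgroup G) ≤ (V : Subgroup G).comap (MonoidHom.id G) := by
    rw [Subgroup.comap_id]; exact coe_le_coe hle
  let f : G ⧸ (V' : Subgroup G) →* G ⧸ (V : Subgroup G) :=
    QuotientGroup.map (V' : Subgroup G) (V : Subgroup G) (MonoidHom.id G) hle'
  have hfs : Function.Surjective f :=
    QuotientGroup.map_surjective_of_surjective _ _ _
      ((QuotientGroup.mk'_surjective (V : Subgroup G)).comp fun x : G => ⟨x, rfl⟩) hle'
  have hcomp : f.comp (QuotientGroup.mk' (V' : Subgroup G)) = QuotientGroup.mk' (V : Subgroup G) :=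
    MonoidHom.ext fun x => QuotientGroup.map_mk' _ _ _ hle' x
  have hPV : P.map (QuotientGroup.mk' (V : Subgroup G)) =
      (P.map (QuotientGroup.mk' (V' : Subgroup G))).map f := by
    rw [Subgroup.map_map, hcomp]
  have hKV : (K ⊔ (V : Subgroup G)).map (QuotientGroup.mk' (V : Subgroup G)) =
      (K.map (QuotientGroup.mk' (V' : Subgroup G))).map f := by
    rw [Subgroup.map_map, hcomp, Subgroup.map_sup, QuotientGroup.map_mk'_self, sup_bot_eq]
  rw [hPV, hKV]
  refine isComplement'_map_of_coprime f hfs hK ?_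
  -- `|f(P̄')| ∣ |P̄'|` and `|K̄'| = [G ⧸ V' : P̄']`
  rw [← hK.symm.index_eq_card]
  exact hcop.coprime_dvd_left (Subgroup.card_map_dvd _ f)

variable [CompactSpace G] [TotallyDisconnectedSpace G]

omit [IsTopologicalGroup G] [CompactSpace G] [TotallyDisconnectedSpace G] in
/-- Level-`V` complements exist: by the finite Schur–Zassenhaus theorem in `G ⧸ V` there is a subgroup
`K ⊇ V` of `G` whose image is a complement of the image of `P`. [cite: RibesZalesskii2010, Thm 2.3.15] -/
theorem exists_le_isComplement'_map_mk' (P : Subgroup G) [P.Normal] (V : OpenNormalSubgroup G)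
    (hcop : Nat.Coprime (Nat.card (P.map (QuotientGroup.mk' (V : Subgroup G))))
      (P.map (QuotientGroup.mk' (V : Subgroup G))).index) :
    ∃ K : Subgroup G, (V : Subgroup G) ≤ K ∧
      IsComplement' (P.map (QuotientGroup.mk' (V : Subgroup G)))
        (K.map (QuotientGroup.mk' (V : Subgroup G))) := by
  haveI : (P.map (QuotientGroup.mk' (V : Subgroup G))).Normal :=
    Subgroup.Normal.map inferInstance _ (QuotientGroup.mk'_surjective _)
  obtain ⟨H, hH⟩ := Subgroup.exists_right_complement'_of_coprime hcop
  refine ⟨H.comap (QuotientGroup.mk' (V : Subgroup G)), ?_, ?_⟩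
  · intro v hv
    have h1 : QuotientGroup.mk' (V : Subgroup G) v = 1 := (QuotientGroup.eq_one_iff v).mpr hv
    rw [Subgroup.mem_comap, h1]
    exact one_mem H
  · rwa [Subgroup.map_comap_eq_self_of_surjective (QuotientGroup.mk'_surjective _)]

/-- In a profinite group the open normal subgroups intersect to `{1}`. [folklore] -/
private theorem eq_one_of_forall_mem_openNormalSubgroup [T2Space G] {x : G}
    (hx : ∀ V : OpenNormalSubgroup G, x ∈ V) : x = 1 := by
  by_contra hne
  obtain ⟨V, hV⟩ := ProfiniteGrp.exist_openNormalSubgroup_sub_open_nhds_of_one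
    (isOpen_compl_singleton (x := x)) (by simpa using fun h => hne h.symm)
  exact hV (hx V) rfl

/-- **Profinite Schur–Zassenhaus theorem (existence of a closed complement).** Let `G` be a profinite
group and `P ⊴ G` a closed normal subgroup such that for every open normal subgroup `V` the image of `P`
in `G ⧸ V` has order prime to its index (e.g. `P` pro-`p` with `G ⧸ P` pro-`p′`). Then there is a CLOSED
subgroup `C ≤ G` which is a complement of `P`: `P ∩ C = 1` and `P · C = G`.
[cite: RibesZalesskii2010, Thm 2.3.15] -/
theorem exists_closed_isComplement'_of_coprime [T2Space G] (P : Subgroup G) [P.Normal]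
    (hPc : IsClosed (P : Set G))
    (hcop : ∀ V : OpenNormalSubgroup G,
      Nat.Coprime (Nat.card (P.map (QuotientGroup.mk' (V : Subgroup G))))
        (P.map (QuotientGroup.mk' (V : Subgroup G))).index) :
    ∃ C : Subgroup G, IsClosed (C : Set G) ∧ IsComplement' P C := by
  classical
  -- the whole group as an open normal subgroup (so that the index type is nonempty)
  haveI : Nonempty (OpenNormalSubgroup G) :=
    ⟨{ toOpenSubgroup := ⊤, isNormal' := by change (⊤ : Subgroup G).Normal; infer_instance }⟩
  -- the inverse system `V ↦ {K ⊇ V | K maps to a complement of the image of P in G ⧸ V}`,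
  -- transition `K ↦ K ⊔ V`
  let F : OpenNormalSubgroup G ⥤ Type u :=
    { obj := fun V => {K : Subgroup G // (V : Subgroup G) ≤ K ∧
        IsComplement' (P.map (QuotientGroup.mk' (V : Subgroup G)))
          (K.map (QuotientGroup.mk' (V : Subgroup G)))}
      map := fun {V' V} f => TypeCat.ofHom fun K =>
        ⟨K.1 ⊔ (V : Subgroup G), le_sup_right,
          isComplement'_map_sup_of_le P (leOfHom f) K.2.2 (hcop V')⟩
      map_id := fun V => ConcreteCategory.hom_ext _ _ fun K => Subtype.ext (by
        change K.1 ⊔ (V : Subgroup G) = K.1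
        exact sup_eq_left.mpr K.2.1)
      map_comp := fun {V₁ V₂ V₃} f g => ConcreteCategory.hom_ext _ _ fun K => Subtype.ext (by
        change K.1 ⊔ (V₃ : Subgroup G) = (K.1 ⊔ (V₂ : Subgroup G)) ⊔ (V₃ : Subgroup G)
        rw [sup_assoc, sup_eq_right.mpr (coe_le_coe (leOfHom g))]) }
  -- the levels are finite (subgroups of the finite groups `G ⧸ V`) and nonempty (finite Schur–Zassenhaus)
  haveI : ∀ V, Finite (F.obj V) := by
    intro V
    haveI : Finite (G ⧸ (V : Subgroup G)) := inferInstance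
    refine Finite.of_injective
      (fun K : F.obj V => (K.1.map (QuotientGroup.mk' (V : Subgroup G)) : Subgroup (G ⧸ (V : Subgroup G))))
      ?_
    intro K₁ K₂ h
    apply Subtype.ext
    have h₁ := Subgroup.comap_map_eq_self (le_ker_mk' V K₁.2.1)
    have h₂ := Subgroup.comap_map_eq_self (le_ker_mk' V K₂.2.1)
    change K₁.1 = K₂.1
    rw [← h₁, ← h₂]
    exact congrArg _ h
  haveI : ∀ V, Nonempty (F.obj V) := fun V => by
    obtain ⟨K, hVK, hK⟩ := exists_le_isComplement'_map_mk' P V (hcop V)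
    exact ⟨⟨K, hVK, hK⟩⟩
  -- a compatible thread of level complements
  obtain ⟨s, hs⟩ := nonempty_sections_of_finite_cofiltered_system F
  -- notation: `K V` the level-`V` subgroup of the thread
  let K : OpenNormalSubgroup G → Subgroup G := fun V => (s V).1
  have hVK : ∀ V : OpenNormalSubgroup G, ((V : Subgroup G) : Subgroup G) ≤ K V := fun V => (s V).2.1
  have hKc : ∀ V : OpenNormalSubgroup G, IsComplement' (P.map (QuotientGroup.mk' (V : Subgroup G)))
      ((K V).map (QuotientGroup.mk' (V : Subgroup G))) := fun V => (s V).2.2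
  have hmono : ∀ {V' V : OpenNormalSubgroup G}, V' ≤ V → K V' ≤ K V := by
    intro V' V h
    have e := congrArg Subtype.val (hs (homOfLE h))
    change (s V').1 ⊔ (V : Subgroup G) = (s V).1 at e
    change (s V').1 ≤ (s V).1
    rw [← e]
    exact le_sup_left
  obtain ⟨V₀⟩ := (inferInstance : Nonempty (OpenNormalSubgroup G))
  -- every `K V` is open (contains `V`), hence closed
  have hKopen : ∀ V, IsOpen (K V : Set G) := fun V =>
    Subgroup.isOpen_mono (hVK V) V.toOpenSubgroup.isOpen
  have hKclosed : ∀ V, IsClosed (K V : Set G) := fun V =>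
    OpenSubgroup.isClosed ⟨K V, hKopen V⟩
  refine ⟨⨅ V, K V, ?_, ?_⟩
  · -- closed: intersection of closed subgroups
    have : ((⨅ V, K V : Subgroup G) : Set G) = ⋂ V, (K V : Set G) := by
      ext x; simp
    rw [this]
    exact isClosed_iInter hKclosed
  refine isComplement'_of_disjoint_and_mul_eq_univ ?_ ?_
  · -- `P ∩ C = 1`: an element of the intersection dies at every level
    rw [disjoint_iff, eq_bot_iff]
    intro x hx
    rw [Subgroup.mem_bot]
    apply eq_one_of_forall_mem_openNormalSubgroup
    intro V
    have hxP : QuotientGroup.mk' (V : Subgroup G) x ∈ P.map (QuotientGroup.mk' (V : Subgroup G)) :=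
      Subgroup.mem_map_of_mem _ hx.1
    have hxK : QuotientGroup.mk' (V : Subgroup G) x ∈ (K V).map (QuotientGroup.mk' (V : Subgroup G)) :=
      Subgroup.mem_map_of_mem _ ((Subgroup.mem_iInf.mp hx.2) V)
    have h1 : QuotientGroup.mk' (V : Subgroup G) x = 1 := by
      have := (hKc V).disjoint
      rw [disjoint_iff] at this
      have hmem : QuotientGroup.mk' (V : Subgroup G) x ∈ P.map (QuotientGroup.mk' (V : Subgroup G)) ⊓
          (K V).map (QuotientGroup.mk' (V : Subgroup G)) := ⟨hxP, hxK⟩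
      rw [this] at hmem
      exact hmem
    exact (QuotientGroup.eq_one_iff x).mp h1
  · -- `P · C = G`: compactness
    refine Set.eq_univ_iff_forall.mpr fun g => ?_
    -- the closed nonempty directed sets `S V = {k ∈ K V | g k⁻¹ ∈ P}`
    let S : OpenNormalSubgroup G → Set G := fun V => (K V : Set G) ∩ {k | g * k⁻¹ ∈ P}
    have hSc : ∀ V, IsClosed (S V) := fun V =>
      (hKclosed V).inter (hPc.preimage (continuous_const.mul continuous_inv))
    have hPn : ∀ V : OpenNormalSubgroup G, (P.map (QuotientGroup.mk' (V : Subgroup G))).Normal :=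
      fun V => Subgroup.Normal.map inferInstance _ (QuotientGroup.mk'_surjective _)
    have hSne : ∀ V, (S V).Nonempty := by
      intro V
      haveI := hPn V
      have hmem : QuotientGroup.mk' (V : Subgroup G) g ∈
          ((P.map (QuotientGroup.mk' (V : Subgroup G)) ⊔
            (K V).map (QuotientGroup.mk' (V : Subgroup G)) : Subgroup _) : Set _) := by
        rw [(hKc V).sup_eq_top]; exact Subgroup.mem_top _
      rw [Subgroup.normal_mul] at hmem
      obtain ⟨n, hn, c, hc, hnc⟩ := Set.mem_mul.mp hmem
      obtain ⟨p, hp, hpn⟩ := Subgroup.mem_map.mp hn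
      obtain ⟨k, hk, hkc⟩ := Subgroup.mem_map.mp hc
      -- `g ≡ p k (mod V)`, so `(p k)⁻¹ g ∈ V ≤ K V`
      have hgk : QuotientGroup.mk' (V : Subgroup G) (p * k) = QuotientGroup.mk' (V : Subgroup G) g := by
        rw [map_mul, hpn, hkc]; exact hnc
      rw [QuotientGroup.mk'_apply, QuotientGroup.mk'_apply, QuotientGroup.eq] at hgk
      refine ⟨p⁻¹ * g, ?_, ?_⟩
      · have : k * ((p * k)⁻¹ * g) = p⁻¹ * g := by group
        rw [← this]
        exact mul_mem hk (hVK V hgk)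
      · show g * (p⁻¹ * g)⁻¹ ∈ P
        rw [mul_inv_rev, inv_inv, mul_inv_cancel_left]
        exact hp
    have hdir : Directed (· ⊇ ·) S := by
      intro V₁ V₂
      refine ⟨V₁ ⊓ V₂, ?_, ?_⟩
      · exact Set.inter_subset_inter_left _ (hmono inf_le_left)
      · exact Set.inter_subset_inter_left _ (hmono inf_le_right)
    obtain ⟨c, hc⟩ := IsCompact.nonempty_iInter_of_directed_nonempty_isCompact_isClosed S hdir hSne
      (fun V => (hSc V).isCompact) hSc
    rw [Set.mem_iInter] at hc
    refine Set.mem_mul.mpr ⟨g * c⁻¹, (hc V₀).2, c, ?_, by group⟩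
    exact Subgroup.mem_iInf.mpr fun V => (hc V).1

/-- **Profinite Schur–Zassenhaus, `p`-primary form.** Let `G` be profinite, `P ⊴ G` closed with `P`
pro-`p` (the image of `P` in every `G ⧸ V` is a `p`-group) and `G ⧸ P` pro-`p′` (the index of the image
of `P` in every `G ⧸ V` is prime to `p`). Then `P` has a closed complement.
[cite: RibesZalesskii2010, Thm 2.3.15] -/
theorem exists_closed_isComplement'_of_isPGroup_of_coprime_index [T2Space G] {p : ℕ} [Fact p.Prime]
    (P : Subgroup G) [P.Normal] (hPc : IsClosed (P : Set G))
    (hP : ∀ V : OpenNormalSubgroup G, IsPGroup p (P.map (QuotientGroup.mk' (V : Subgroup G))))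
    (hQ : ∀ V : OpenNormalSubgroup G,
      Nat.Coprime p (P.map (QuotientGroup.mk' (V : Subgroup G))).index) :
    ∃ C : Subgroup G, IsClosed (C : Set G) ∧ IsComplement' P C := by
  refine exists_closed_isComplement'_of_coprime P hPc fun V => ?_
  haveI : Finite (G ⧸ (V : Subgroup G)) := inferInstance
  obtain ⟨n, hn⟩ := (hP V).exists_card_eq
  rw [hn]
  exact Nat.Coprime.pow_left n (hQ V)

end Profinite

end Literature.GroupTheory
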